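import Summits.QuantumFields.BalabanUV.T4Continuum.Spine.NE1p.DressedTerminalWitnessReuse

/-!
# T⁴ programme, spine estimate NE1′ (node O3b/H2) — A TERMINAL FACE FIRES BY REUSE, part 2: the CANONICAL TERMINAL FACE (row S3l)
# applied BY NAME to row W7's function-level toy at EVERY INTEGER blocking factor `81 ≤ L ≤ 120` — the row root with displayed
# integer constants, the root literally, and ROOT-B (swarm item W11r «the canonical terminal face fires on `towerM` unchanged at
# every integer L ∈ [81,120] with the H2 dictionary live» of `t4/formal/NE1p/LEAVES.md`, typer R-T60 (i); INTENT CLAIMS.log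
# l.11450, READY-FILE OFFER l.11576)

Cell `pub-balaban`, sub-cell `t4`, BINDER-OWNERS row NE1′, formalisation crew `b2b-balaban-t4-ne1p-formalise-*`, seat `…-leaf-02`
(gen 4).  ADDITIVE — imports part 1 `Spine/NE1p/DressedTerminalWitnessReuse` (through it leaf-09's row S3l
`Spine/NE1p/DressedStabilityOfCanonicalSliceWinSchedules` p215128: THE CANONICAL TERMINAL FACE, three theorems; part 1 itself: the integer window `81 ≤ Lb ≤ 120` against
`LW = 6e³ ∈ (120, 121)`, rate ∕ birth-decay domination `psi_le_psiL` ∕ `tau_pow_le`, the located largeness `hloc_int` and the (w6)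
window `hsmall_int` with EQUALITY; the integer-`L` data `anchM` ∕ `compM` ∕ `SM` ∕ `SgM` ∕ `𝒬T` on W7's booking with `hmultM` ∕
`hscaleM` ∕ `hhousedM` ∕ `hvolM` ∕ `hSgT` ∕ `hQT` ∕ `hFnT` ∕ `hδfT` ∕ `hrateT` ∕ `hβT` ∕ `habsM`; the booking convention `hneM` ∕ `hsupM`)
ONLY; modifies nothing.  See part 1's module docstring for WHY (leaf-09-g3's located observation l.11316, LF-4) and the KEY
ARITHMETIC POINT (no function-level datum re-instantiated: W7's rates `LW⁻²`∕`LW⁻³` are dominated by the face's `L⁻²`∕`L⁻³` iff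
`L ≤ LW`; `hloc`∕`hsmall` at the reused dictionary constant force `L ≥ 4e³`, so the window is `81 ≤ L ≤ 120`).
* §4 **`dressedStabilityWith_towerM_integer`**: for every `Lb : ℕ` with `81 ≤ Lb ≤ 120`,
  `DressedStabilityWith towerM 1 (rhoOne Lb⁻² 2 0 ½) Lb⁻³` by `dressedStabilityWith_of_canonicalSliceWinSchedules` BY NAME — its ≈ 50
  displayed binders inhabited AT ONCE: scalars ONCE (`κ = ½`, `L = Lb`, `c̄ = 0`, `N₀ = A₀ = 1`, `s̄⁰ = 0`, `ρ′ = ¾`, `r = 1`,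
  `c_δ = ½`, `m = ¼`, `v = mB = 1`, `A = 0`, `β₀ = 1`), ONE cutoff-free schedule `fun _ _ => Wm` (`hratioM`), per `(a, K)` W7's lemmas
  (`hslM`, `FnM_succ`, `hQM`, `relGauge_pairs`, `hδfwkM`, `hdefwkM`, `hcmM`, `hDμM`, `hz₁M`, `hregM`, `realBaseAt_W`,
  `exponentSliceAt_M`, `mem_bddClass_flAt`, `aesm_flAt`) and part 1's; then two kernel-checked `example`s — the root
  `DressedStability towerM` LITERALLY (the face's packing) and ROOT-B `DressedBudget towerM wt` for every bounded nonnegative run-weight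
  family by `dressedBudget_of_canonicalSliceWinSchedules` BY NAME (examples, not theorems: both CLOSED statements are already in the
  tree for this tower — W7's `dressedStability_towerM` via END-B, W7c's `dressedBudget_towerM_allCutoffs` via S3h-2 — and the gate's
  `dedup.landed` protects them; the importable content is the With-form with displayed INTEGER constants).  LIVE vs ≡ 0 (R-T56 (h)(2)):
  births `hsl`, step law `hFn` (EQUALITY), dictionary `hQ` (EQUALITY), source tie `hcm` (EQUALITY ¼ = ¼), (I4′) links, fresh pairs,
  the booking convention, the anchoring ∕ housing data and the absorption-free birth identity (EQUALITY) are LIVE; the action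
  exponent `𝒜 ≡ 0` with margin `s ≡ 0` and the regeneration constants `creg ≡ 0` are DECLARED ≡ 0 (W9 ∕ W10 carry those corners live
  at the cell constant; part 1's `half_margin_needs_LW` and leaf-07-g5's row S3c.1 record why THE NUMBER `½` cannot ride below `LW`);
  absorption `Sabs ≡ ∅` is DECLARED ∅ (live at booking level in W3∕W8, at function level in W13).  The conclusions are
  obtained by APPLYING THE FACE (R-T56 (h)(4)), not END-B directly (that is W7's `dressedStability_towerM`, a different route).
* §5 the decided instance at `Lb = 100`: `dressedStabilityWith_towerM_hundred`, and `rhoOne_hundred_lt` (family factor `< 1∕100`).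

WHAT IT IS NOT.  Not an estimate; a joint-satisfiability certificate for the binder SHAPES of the canonical terminal face on a
DECIDED toy (labelled toy), uniformly in the cutoff, at integer blocking factors — the referee's (t5) column for the terminal
theorem, JOINTLY (before: two halves, W7c + W8); nothing of Bałaban's densities, of [Balaban1989LargeFieldII] (1.65)∕(1.71)–(1.75)∕
(1.89) or of B15∕B12 is encoded or asserted (CONTEXT only); theorems only, no `def`, no `def … : Prop`; [folklore] toy kernel
mathematics, 0 sorry, 0 citations used as facts.  It changes NOTHING about the walls: (w1)∕(w2-act)∕(w5)∕(I4′)-rate∕(w4)-constant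
remain DISPLAYED binders of the terminal face, open.

HONEST FRAMING.  Rung (B)+1 bookkeeping on ONE finite four-torus of fixed physical size — NOT infinite volume, NOT a mass gap, NOT
OS on ℝ⁴, NOT the Clay problem, NOT summit progress.  Headline (c4): «the canonical terminal face FIRES on the crew's function-level
toy `towerM` UNCHANGED at every integer blocking factor 81 ≤ L ≤ 120 (decided instance L = 100), H2 dictionary live; 𝒜 ≡ 0, s ≡ 0,
creg ≡ 0, Sabs ≡ ∅ declared; non-vacuity of SHAPES — nothing of Bałaban's densities; NE1′ ⇐ the named binders, NOT proved, NOT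
printed»; spine PROVED 0∕9 unchanged.  HONEST DEPENDENCY: continuum YM on T⁴ ⇐ BetaPertH ∧ nine spine estimates (0/9 proved); BetaPertH ⇐ (D1) ∧ (D4) ∧
CAP+tail; G-an2-4 gates asym, D1 and NE2/3/4.
-/

noncomputable section

namespace Summit.QuantumFields.BalabanUV.T4Continuum.NE1p.DressedTerminalWitnessReuseEnd

open MeasureTheory Set Metric Filter Finset
open scoped BigOperators
open Literature.MathematicalPhysics.QuantumFieldTheory.Balaban1983to89
open Literature.MathematicalPhysics.QuantumFieldTheory.Balaban1983to89.T4TermFormat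
open Literature.MathematicalPhysics.QuantumFieldTheory.Balaban1983to89.T4TermFormat.Booking
open Literature.MathematicalPhysics.QuantumFieldTheory.Balaban1983to89.T4FeltGeometry
open Literature.MathematicalPhysics.QuantumFieldTheory.Balaban1983to89.T4GatedBooking
open Literature.MathematicalPhysics.QuantumFieldTheory.Balaban1983to89.T4TrajectoryComparison
open Literature.MathematicalPhysics.QuantumFieldTheory.Balaban1983to89.T4TrajectoryModulus
open T4TrajectoryModulus (bondBall bondBall_add_mem bondBall_latMove_add_mem bondBall_diam)
open T4BlockTransport (Fld NDir latMove latN Site norm_dir_le)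
open T4BirthChartTransport (GaugeInvariant BirthSlice RelGauge)
open T4TrajectoryDensity
open Summit.QuantumFields.BalabanUV.T4Continuum.T4TrajectoryDensityDressed
open Summit.QuantumFields.BalabanUV.T4Continuum.T4TrajectoryDensityWitness
open Summit.QuantumFields.BalabanUV.T4Continuum.NE1p.DressedRoot
open Summit.QuantumFields.BalabanUV.T4Continuum.NE1p.DressedUniformConstants
open Summit.QuantumFields.BalabanUV.T4Continuum.NE1p.DressedWindowScheduleWin
open Summit.QuantumFields.BalabanUV.T4Continuum.NE1p.DressedWindowScheduleModWin
open Summit.QuantumFields.BalabanUV.T4Continuum.NE1p.DressedAbsorptionWindow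
open Summit.QuantumFields.BalabanUV.T4Continuum.NE1p.DressedTowerWitness
open Summit.QuantumFields.BalabanUV.T4Continuum.NE1p.DressedTowerWitnessSlice
open Summit.QuantumFields.BalabanUV.T4Continuum.NE1p.DressedTransportAssembledModData
open Summit.QuantumFields.BalabanUV.T4Continuum.NE1p.DressedStabilityOfCanonicalSliceWinSchedules
open Summit.QuantumFields.BalabanUV.T4Continuum.NE1p.DressedCellNecessity

open Summit.QuantumFields.BalabanUV.T4Continuum.NE1p.DressedTerminalWitnessReuse

/-! ## §4 THE CANONICAL TERMINAL FACE FIRES ON W7's TOY AT EVERY INTEGER `81 ≤ L ≤ 120` [decided toy] -/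

section Fires

variable (Lb : ℕ) (h81 : 81 ≤ Lb) (h120 : Lb ≤ 120)
include h81 h120

/-- **THE CANONICAL TERMINAL FACE FIRES — CONSTANTS DISPLAYED AT THE INTEGER `Lb`** [decided toy]: for every `81 ≤ Lb ≤ 120`,
`DressedStabilityWith towerM 1 (rhoOne Lb⁻² 2 0 ½) Lb⁻³` by leaf-09's `dressedStabilityWith_of_canonicalSliceWinSchedules` BY NAME,
its whole displayed list inhabited AT ONCE on W7's function-level toy: scalars ONCE (`κ = ½`, `L = Lb`, `c̄ = 0`, `N₀ = A₀ = 1`,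
`s̄⁰ = 0`, `ρ′ = ¾`, `r = 1`, `c_δ = ½`, `m = ¼`; `hloc_int`, `hsmall_int` with equality), ONE cutoff-free schedule `fun _ _ => Wm`
(`hratioM`), and per `(a,K)`: (w1) `hslM` (LIVE births), `hFn := hFnT` (W7's `FnM_succ`, EQUALITY), `h𝒢`, (w2-act) `hB`∕`hE` by
W5's zero-action lemmas (`𝒜 ≡ 0`, `s ≡ 0` — DECLARED ≡ 0), (I4′) `hδfT`∕`hrateT` at rate `Lb⁻²` + `hδfwkM`∕`hdefwkM`∕`relGauge_pairs`
(LIVE), `hinv` (`rel := Eq`), `hmeas`, the booking convention `hneM`∕`hsupM` (bounded attained increments), (w5) `hregM` with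
`creg ≡ 0` (DECLARED ≡ 0), `hs₀`, anchoring `anchM K Lb` with `hLb := rfl`, `hmultM`, housing `compM`∕`hscaleM`∕`hhousedM`∕`hvolM`,
absorption-free births `Sabs ≡ ∅`∕`habsM` (EQUALITY)∕`hβT`, the dictionary `hQT` (EQUALITY, W7's `hQM`) with `hSgT`, `hcmM`
(EQUALITY `¼ = ¼`), `hvN₀_int`, `hfan_int`, `hamp_int`.  Non-vacuity of SHAPES; nothing of Bałaban's densities. [folklore] -/
theorem dressedStabilityWith_towerM_integer :
    DressedStabilityWith towerM 1 (rhoOne ((Lb : ℝ) ^ 2)⁻¹ (4 * (1 / 2) / 1) 0 (1 / 2)) ((Lb : ℝ)⁻¹ ^ 3) :=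
  dressedStabilityWith_of_canonicalSliceWinSchedules towerM (κ := 1 / 2) (L := (Lb : ℝ)) (cbar := 0) (N₀ := 1) (A₀ := 1)
    (sbar := 0) (ρ' := 3 / 4) (r := 1) (cδ := 1 / 2) (m := 1 / 4) (w := fun _ _ => 1) (fun _ _ => Wm) (by norm_num)
    (Fn := fun _ K _ k' k => FnM K k' k) (rel := fun _ _ _ _ _ U U' => U = U') (ref := fun _ _ _ _ U => U)
    (base := fun _ _ _ _ => base₁) (𝒜 := fun _ _ _ _ => zeroExp) (𝒬 := fun _ K _ k => 𝒬T K k) (q := fun _ _ _ _ _ => 0)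
    (μ := fun _ _ _ k => flAt (atomW (k + 1))) (z₀ := fun _ _ _ _ => 0) (z₁ := fun _ _ _ _ => 0)
    (defect := fun _ _ _ _ k => defW (k + 1)) (s := fun _ _ _ _ => 0) (S := fun _ K k b => SM K k b)
    (Sg := fun _ K k b => SgM K k b) (c := fun _ _ _ _ => (((1 / 4 : ℝ)) : ℂ)) (δf := fun _ _ _ k _ => dfW k)
    (creg := fun _ _ _ => 0) (Lb := Lb) (mB := 1) (v := 1) (fun _ K => anchM K Lb) (comp := fun _ K k b => compM K k b)
    (Sabs := fun _ _ _ => ∅) (β := fun _ K _ => (LW⁻¹ ^ 3) ^ K) (A := 0) (β₀ := 1)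
    (fun _ _ => hratioM) (one_le_natL h81) le_rfl zero_le_one zero_le_one (by norm_num) (hloc_int h81) hρ'_int hsmall_int
    one_pos (by norm_num)
    (fun _ K b k' _ _ _ => birthSlice_anti_window (hslM K b k') (Wm.hwcw k'))
    (fun _ K _ k' k _ _ hk _ U => hFnT K k' k hk U) (fun _ _ _ _ k _ _ _ _ _ => mem_bddClass_flAt _ _)
    (fun _ _ _ _ k _ _ _ _ => realBaseAt_W _ _) (fun _ _ _ _ k _ _ _ _ => exponentSliceAt_M _ _ _ _)
    (fun _ K b k x hx => hδfT h81 h120 K k b x hx) (fun _ _ _ k => hDμM k) (fun _ _ _ k => hz₁M k)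
    (fun _ _ _ _ k _ _ _ _ U₀ _ pd _ _ => (relGauge_pairs k).mono fun z hz t _ => hz (latMove U₀ pd t))
    (fun _ _ _ _ _ _ _ h => h ▸ rfl) (fun _ _ _ _ _ k _ => aesm_flAt _ _) (fun _ _ _ _ k => hdefwkM k)
    (fun _ _ _ k' k _ _ _ => hrateT h81 h120 k' k) (fun _ _ _ _ k _ _ _ _ => hneM k)
    (fun _ K b k' k _ _ _ _ => hsupM K b k' k) (fun _ _ _ => le_rfl) (fun _ _ _ _ => le_rfl) (fun _ K => hregM K _)
    (fun _ _ _ _ => le_rfl) rfl (fun _ K => hmultM K Lb) (fun _ K => hscaleM K) (fun _ K => hhousedM K) (fun _ K => hvolM K)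
    (fun _ _ _ _ h => by simp at h) (fun _ _ _ => Finset.empty_subset _) (fun _ K => habsM K _ _)
    (fun _ K j hj => hβT h81 h120 K j hj) (fun _ K b k => hQT K b k) (fun _ K => hSgT K) (fun _ _ _ _ => hcmM)
    (fun _ _ _ k _ _ => hδfwkM k) hvN₀_int le_rfl hfan_int hamp_int

/-! **THE ROW ROOT `DressedStability towerM` LITERALLY, BY APPLYING THE FACE** [decided toy]: leaf-09's
`dressedStability_of_canonicalSliceWinSchedules` packs the With-form into the root; on W7's toy at the integer `Lb` this is the
kernel-checked `example` below (an `example`, not a theorem: the closed statement `DressedStability towerM` is ALREADY in the tree as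
W7's `dressedStability_towerM` through END-B directly, and the gate's `dedup.landed` rightly refuses a second declaration of it —
the importable content of this file is the With-form with its displayed integer constants; the referee's (t5) column for the
terminal theorem, JOINTLY). [folklore] -/
example : DressedStability towerM :=
  ⟨_, _, _, dressedStabilityWith_towerM_integer Lb h81 h120⟩

/-! **ROOT-B THROUGH THE CANONICAL TERMINAL FACE AT THE INTEGER `Lb`** [decided toy]: for EVERY run-weight family
`0 ≤ wt () K j ≤ w̄` (`j ≤ K`), `DressedBudget towerM wt` by leaf-09's `dressedBudget_of_canonicalSliceWinSchedules` BY NAME — the SAME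
displayed list, the weights, and the SAME anchoring read as the bookings' positional count (`1 ≤ v = 1`).  An `example`, not a
theorem: the statement coincides with W7c's `dressedBudget_towerM_allCutoffs` (reached through S3h-2's budget face at `LW`), which the
gate's `dedup.landed` protects; what is checked here is that the TERMINAL face's ROOT-B theorem fires on the integer-`L` data. [folklore] -/
example {wbar : ℝ} {wt : Unit → ℕ → ℕ → ℝ} (hwbar : 0 ≤ wbar)
    (hw0 : ∀ p K, ∀ j ≤ K, 0 ≤ wt p K j) (hwb : ∀ p K, ∀ j ≤ K, wt p K j ≤ wbar) : DressedBudget towerM wt :=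
  dressedBudget_of_canonicalSliceWinSchedules towerM (κ := 1 / 2) (L := (Lb : ℝ)) (cbar := 0) (N₀ := 1) (A₀ := 1)
    (sbar := 0) (ρ' := 3 / 4) (r := 1) (cδ := 1 / 2) (m := 1 / 4) (w := fun _ _ => 1) (fun _ _ => Wm) (by norm_num)
    (Fn := fun _ K _ k' k => FnM K k' k) (rel := fun _ _ _ _ _ U U' => U = U') (ref := fun _ _ _ _ U => U)
    (base := fun _ _ _ _ => base₁) (𝒜 := fun _ _ _ _ => zeroExp) (𝒬 := fun _ K _ k => 𝒬T K k) (q := fun _ _ _ _ _ => 0)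
    (μ := fun _ _ _ k => flAt (atomW (k + 1))) (z₀ := fun _ _ _ _ => 0) (z₁ := fun _ _ _ _ => 0)
    (defect := fun _ _ _ _ k => defW (k + 1)) (s := fun _ _ _ _ => 0) (S := fun _ K k b => SM K k b)
    (Sg := fun _ K k b => SgM K k b) (c := fun _ _ _ _ => (((1 / 4 : ℝ)) : ℂ)) (δf := fun _ _ _ k _ => dfW k)
    (creg := fun _ _ _ => 0) (Lb := Lb) (mB := 1) (v := 1) (fun _ K => anchM K Lb) (comp := fun _ K k b => compM K k b)
    (Sabs := fun _ _ _ => ∅) (β := fun _ K _ => (LW⁻¹ ^ 3) ^ K) (A := 0) (β₀ := 1)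
    (fun _ _ => hratioM) (one_le_natL h81) le_rfl zero_le_one zero_le_one (by norm_num) (hloc_int h81) hρ'_int hsmall_int
    one_pos (by norm_num)
    (fun _ K b k' _ _ _ => birthSlice_anti_window (hslM K b k') (Wm.hwcw k'))
    (fun _ K _ k' k _ _ hk _ U => hFnT K k' k hk U) (fun _ _ _ _ k _ _ _ _ _ => mem_bddClass_flAt _ _)
    (fun _ _ _ _ k _ _ _ _ => realBaseAt_W _ _) (fun _ _ _ _ k _ _ _ _ => exponentSliceAt_M _ _ _ _)
    (fun _ K b k x hx => hδfT h81 h120 K k b x hx) (fun _ _ _ k => hDμM k) (fun _ _ _ k => hz₁M k)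
    (fun _ _ _ _ k _ _ _ _ U₀ _ pd _ _ => (relGauge_pairs k).mono fun z hz t _ => hz (latMove U₀ pd t))
    (fun _ _ _ _ _ _ _ h => h ▸ rfl) (fun _ _ _ _ _ k _ => aesm_flAt _ _) (fun _ _ _ _ k => hdefwkM k)
    (fun _ _ _ k' k _ _ _ => hrateT h81 h120 k' k) (fun _ _ _ _ k _ _ _ _ => hneM k)
    (fun _ K b k' k _ _ _ _ => hsupM K b k' k) (fun _ _ _ => le_rfl) (fun _ _ _ _ => le_rfl) (fun _ K => hregM K _)
    (fun _ _ _ _ => le_rfl) rfl (fun _ K => hmultM K Lb) (fun _ K => hscaleM K) (fun _ K => hhousedM K) (fun _ K => hvolM K)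
    (fun _ _ _ _ h => by simp at h) (fun _ _ _ => Finset.empty_subset _) (fun _ K => habsM K _ _)
    (fun _ K j hj => hβT h81 h120 K j hj) (fun _ K b k => hQT K b k) (fun _ K => hSgT K) (fun _ _ _ _ => hcmM)
    (fun _ _ _ k _ _ => hδfwkM k) hvN₀_int le_rfl hfan_int hamp_int hwbar hw0 hwb le_rfl

end Fires

/-! ## §5 The decided instances at `L = 100` [decided toy] -/

/-- **DECIDED: THE TERMINAL FACE AT `L = 100`** — `DressedStabilityWith towerM 1 (rhoOne 100⁻² 2 0 ½) 100⁻³` (family factor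
`3e³∕10⁴ < 1`, `τ = 10⁻⁶`). [folklore] -/
theorem dressedStabilityWith_towerM_hundred :
    DressedStabilityWith towerM 1 (rhoOne (((100 : ℕ) : ℝ) ^ 2)⁻¹ (4 * (1 / 2) / 1) 0 (1 / 2)) (((100 : ℕ) : ℝ)⁻¹ ^ 3) :=
  dressedStabilityWith_towerM_integer 100 (by norm_num) (by norm_num)

/-- The family factor at `L = 100` is `3e³∕10⁴ < 1` (indeed `< 1∕100`): the displayed class contracts. [folklore] -/
theorem rhoOne_hundred_lt : rhoOne (((100 : ℕ) : ℝ) ^ 2)⁻¹ (4 * (1 / 2) / 1) 0 (1 / 2) < 1 / 100 := by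
  unfold rhoOne alphaCell
  have h := exp_three_lt_20_09
  norm_num
  nlinarith

end Summit.QuantumFields.BalabanUV.T4Continuum.NE1p.DressedTerminalWitnessReuseEnd

end
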